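import Mathlib
import Summits.NavierStokesRegularity.NavierStokesRegularity.Theorems.FilamentSkeletonRssClause13ScalingBounds
import Summits.NavierStokesRegularity.NavierStokesRegularity.Theorems.FilamentSkeletonRssClause13ScalingBallBand
import Summits.NavierStokesRegularity.NavierStokesRegularity.Theorems.FilamentSkeletonRssClause13ModelGluingClosed

/-!
# Clause 13-J/13-R, model step C7 (CLAUSE SCALING): the MODEL 13-J∘ in `L²`, Γ-uniformly, on balls of radius `R_b√(Γ log Γ)`

Route `FilamentSkeletonRss`, ∃-side clause 13 (`Clause13RNearStraightL`, stmt-NavierStokesRegularity-23612; typing-agnostic); design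
`filament-plan/DESIGN-28296-model-L2closed-and-Linfty-g17.md` §2 (director dss_153: "clause-scaling corollary").
* §1 `scaling_smallness` — assembly of `…Clause13ScalingBounds` / `…Clause13ScalingBallBand`: in the atoms `t ≥ T_min`, `s ≥ S_min`, `s ≤ 8t`,
  `g t⁸ ≤ G ≤ g′t⁸`, `R = R_b t⁴√s`, `x_s = 1/t`, `X = 4s`, `θ = θ₀/R`, `η = η₀`, `L₁ + L₂ ≤ l/t²`, `R_b M_δ₁ ≤ 1/200`, the smallness condition
  `6(δ₁+δ₂+2δ₃+δ₅+δ₆) ≤ ½` of `model_l2_estimate_closed` holds and `12(α₁+α₂+2α₃+α₅+α₆) ≤ A` with `A` Γ-free (explicit);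
* §2 `scl_gamma_atoms` — the dictionary `t = Γ^{1/8}`, `s = log Γ` (`t⁸ = Γ`, `log Γ ≤ 8Γ^{1/8}`, `√(Γ log Γ) = t⁴√s`, `e^{-2 log Γ} = t⁻¹⁶`,
  `Γ^{-1/4} = t⁻²`);
* §3 ★ `model_l2_estimate_scaled` — for fixed model constants `q, g, g′, Λ, Λ₂, b₁, b₂, β₀, l` there is `R_b0 > 0` such that for every
  `0 < R_b ≤ R_b0` there are `Γ₀` and a Γ-FREE constant `A` with: for all `Γ ≥ Γ₀`, all `G ∈ [gΓ, g′Γ]`, all multiplier Lipschitz sizes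
  `L₁ + L₂ ≤ l Γ^{-1/4}`, every slip `w` (`w(c) = 0`, `|w′| ≤ Λ`, `|w″| ≤ Λ₂`), multipliers `β₁, β₂` (`|β₁| ≤ b₁`, `|β₂| ≤ b₂`, growth
  `β₀ ≤ ½w′ + Re β₁`) and every `C¹_c` variation `Y` supported in `[c − R_b√(Γ log Γ), c + R_b√(Γ log Γ)]`:
  `N(Y) ≤ A · N(iG((2/q)Y − K_q∗Y) − wY′ + β₁Y + β₂Ȳ)` — the MODEL 13-J∘ `L²` estimate in the clause scaling, no kernel, window or
  smallness hypothesis left.  (The dictionary `G ≍ Γ`, `R = R_b√(Γ log Γ)`, `L ≲ Γ^{-1/4}` is the one of the design memos; the clause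
  reduction c1 must deliver it.)
Lane ns-filament-19175-p1 g17; `--supports stmt-NavierStokesRegularity-23612 --as helper`.
HONEST FRAMING: an estimate for an explicit 1-D model operator attached to a HYPOTHETICAL filament skeleton on the NEGATIVE side of a MODEL
route; nothing here bears on Navier–Stokes regularity or blow-up.
-/

noncomputable section

open Real Complex MeasureTheory
open scoped ComplexConjugate

namespace Summit.NavierStokesRegularity.NavierStokesRegularity.Theorems.MatchedKernel
set_option linter.dupNamespace false

/-! ## §1 Assembly of the scaling bounds -/

/-- **ASSEMBLY.**  In the clause scaling (atoms as in the module docstring, `t ≥ T_min`, `s ≥ S_min`, `R_b·M_δ₁ ≤ 1/200`) the smallness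
condition of `model_l2_estimate_closed` holds, `12Σα ≤ A`, and the side conditions `ε < 1`, `0 < θ, η, x_s, G`, `x_s ≤ 1/10`, `X ≥ 7/2`,
`R ≥ 0` hold. -/
theorem scaling_smallness
    {C q g g' Λ Λ₂ b₁ b₂ β₀ l t s G R Rb L₁ L₂ xs X lg1 lg2 eX θ θ₀ η
      gS0 ε ℓ cH CF RW αT δT α₁ α₂ α₃ α₅ α₆ δ₁ δ₂ δ₃ δ₅ δ₆ M₁ M₂ M₃ M₅ M₆ M₆' Tmin Smin A : ℝ}
    (hC : 0 ≤ C) (hq : 0 < q) (hg : 0 < g) (hΛ : 0 ≤ Λ) (hΛ₂ : 0 ≤ Λ₂) (hb₁ : 0 ≤ b₁) (hb₂ : 0 ≤ b₂) (hβ₀ : 0 < β₀) (hl : 0 ≤ l)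
    (ht : 1 ≤ t) (hs : 1 ≤ s) (hst : s ≤ 8 * t) (hG : g * t ^ 8 ≤ G) (hG' : G ≤ g' * t ^ 8)
    (hRb : 0 < Rb) (hRb1 : Rb ≤ 1) (hR : R = Rb * t ^ 4 * Real.sqrt s) (hL₁ : 0 ≤ L₁) (hL₂ : 0 ≤ L₂) (hL : L₁ + L₂ ≤ l / t ^ 2)
    (hxs : xs = 1 / t) (hX : X = 4 * s) (hlg1 : lg1 = s / 8) (hlg2 : s / 8 ≤ lg2) (heX : eX = 1 / t ^ 16)
    (hθ₀ : θ₀ = Real.pi * √q / (4800 * (C ^ 2 + 1))) (hθ : θ = θ₀ / R) (hη : η = β₀ / (21600 * (1 + C) * Λ + 1))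
    (egS0 : gS0 = G * (1 / 2 * lg1)) (eε : ε = b₂ * q / (4 * G)) (eℓ : ℓ = L₂ * q / (4 * G))
    (ecH : cH = (1 + ε) * G * (2 / q * (5 * eX)) + 2 * b₁ * ε + 2 * (2 * G / q) * ε ^ 2)
    (eCF : CF = Λ₂ * ((C * √q / X) + (C * √q / X)) + (L₁ + L₂) * (C * √q / X)) (eRW : RW = R + Real.sqrt 2 * (C * R + (C * √q / X)))
    (eαT : αT = C ^ 2 / (G * (2 / q * (1 / 50))))
    (eδT : δT = ((Λ * (C + C) + (L₁ + L₂) * (C * √q / X) + (b₁ + b₂) * C + Real.sqrt 2 * Λ * C) + Real.sqrt 2 * Λ * (C * X / √q) * R)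
      * C / (G * (2 / q * (1 / 50))))
    (eα₁ : α₁ = q / θ ^ 2 * (2 / gS0) * C ^ 2)
    (eδ₁ : δ₁ = θ / (Real.pi * √q) * C ^ 2 * (2 * R)
      + q / θ ^ 2 * (2 / gS0 * ((Λ * (C + C) + (L₁ + L₂) * (C * √q / xs)) * C + (b₁ + b₂) * C ^ 2)
        + Λ ^ 2 / gS0 ^ 2 * (2 * (C * R + (C * √q / xs)) ^ 2)))
    (eα₂ : α₂ = C ^ 2 / (G * (2 / q * (xs ^ 2 / 16 * lg2))))
    (eδ₂ : δ₂ = ((Λ * (C + C) + (L₁ + L₂) * (C * √q / xs) + (b₁ + b₂) * C + Real.sqrt 2 * Λ * C) + Real.sqrt 2 * Λ * (C / √q) * R) * C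
      / (G * (2 / q * (xs ^ 2 / 16 * lg2))))
    (eα₃ : α₃ = √q * (Real.sqrt 2 * ((C + C) * R + ((C * √q) + (C * √q)))) * (C + C) / (G * (153 / 4000)))
    (eδ₃ : δ₃ = √q * (Real.sqrt 2 * ((C + C) * R + ((C * √q) + (C * √q))))
      * (Λ * ((C + C) + (C + C)) + (L₁ + L₂) * ((C * √q) + (C * √q)) + (Λ + b₁ + 3 * b₂) * (C + C)) / (G * (153 / 4000)))
    (eα₅ : α₅ = C ^ 2 / (G * (2 / q * (1 / 50))))
    (eδ₅ : δ₅ = ((Λ * (C + C) + (L₁ + L₂) * (C * √q) + (b₁ + b₂) * C + Real.sqrt 2 * Λ * C) + Real.sqrt 2 * Λ * (C * X / √q) * R) * C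
      / (G * (2 / q * (1 / 50))))
    (eα₆ : α₆ = (1 + ε) ^ 2 * (1 + C) * ((1 + C) + Λ * αT / (2 * η)) / (β₀ * (1 - ε) ^ 2))
    (eδ₆ : δ₆ = ((1 + ε) ^ 2 * (1 + C) * Λ * (δT / (2 * η) + η / 2) + (1 + ε) * (1 + C) * ((1 + ε) * CF + cH * (1 + C) + ℓ * Λ * RW))
      / (β₀ * (1 - ε) ^ 2))
    (eM₁ : M₁ = 32 * q * (2 * Λ + l * √q + b₁ + b₂) * C ^ 2 / (θ₀ ^ 2 * g) + 1024 * q * Λ ^ 2 * C ^ 2 * (1 + q) / (θ₀ ^ 2 * g ^ 2))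
    (eM₂ : M₂ = 64 * q * (4 * Λ + l * √q + b₁ + b₂) * C ^ 2 / g + 128 * Λ * C ^ 2 * √q / g)
    (eM₃ : M₃ = 216 * √q * C ^ 2 * (8 + √q) * (3 * Λ + l * √q + b₁ + 3 * b₂) / g)
    (eM₅ : M₅ = 25 * q * (4 * Λ + l * √q + b₁ + b₂) * C ^ 2 / g + 12800 * Λ * C ^ 2 * √q / g)
    (eM₆ : M₆ = 9 * (1 + C) * Λ * M₅ / (2 * η * β₀) + 6 * (1 + C) ^ 2 * (15 * g' / q + b₁ * b₂ * q / (2 * g) + b₂ ^ 2 * q / (4 * g)) / β₀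
      + 6 * (1 + C) * (Λ * l * q * (8 * (1 + 2 * C) + C * √q) / (4 * g)) / β₀)
    (eM₆' : M₆' = 9 * (1 + C) * ((2 * Λ₂ + l) * C * √q / 4) / β₀)
    (eTmin : Tmin = 10 + b₂ * q / (2 * g) + 100 * M₂ + 100 * M₃ + 100 * M₅ + 400 * M₆) (eSmin : Smin = 1 + 400 * M₆')
    (eA : A = 12 * (32 * q * C ^ 2 / (θ₀ ^ 2 * g) + 64 * q * C ^ 2 / g + 2 * (216 * √q * C ^ 2 * (8 + √q) / g) + 25 * q * C ^ 2 / g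
      + 9 * (1 + C) * ((1 + C) + Λ * (25 * q * C ^ 2 / g) / (2 * η)) / β₀))
    (htT : Tmin ≤ t) (hsS : Smin ≤ s) (hRbM : Rb * M₁ ≤ 1 / 200) :
    6 * (δ₁ + δ₂ + δ₃ + δ₃ + δ₅ + δ₆) ≤ 1 / 2 ∧ 12 * (α₁ + α₂ + α₃ + α₃ + α₅ + α₆) ≤ A ∧
      ε < 1 ∧ 0 < θ ∧ 0 < η ∧ 0 < xs ∧ xs ≤ 1 / 10 ∧ 7 / 2 ≤ X ∧ 0 < G ∧ 0 ≤ R := by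
  have ht0 : 0 < t := by linarith
  have hs0 : 0 < s := by linarith
  have hsq : 0 < √q := Real.sqrt_pos.2 hq
  obtain ⟨hG0, -, -, -⟩ := scl_G hg ht hG
  have hg' : 0 < g' := by
    have h := hG.trans hG'
    exact lt_of_lt_of_le hg (le_of_mul_le_mul_right h (by positivity))
  have hθ₀0 : 0 < θ₀ := by rw [hθ₀]; positivity
  have hη0 : 0 < η := by rw [hη]; positivity
  have hR0 : 0 ≤ R := by rw [hR]; positivity
  -- the Γ-free constants are nonnegative
  have hM₂0 : 0 ≤ M₂ := by rw [eM₂]; positivity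
  have hM₃0 : 0 ≤ M₃ := by rw [eM₃]; positivity
  have hM₅0 : 0 ≤ M₅ := by rw [eM₅]; positivity
  have hM₆0 : 0 ≤ M₆ := by rw [eM₆]; positivity
  have hM₆'0 : 0 ≤ M₆' := by rw [eM₆']; positivity
  have hbq : 0 ≤ b₂ * q / (2 * g) := by positivity
  -- thresholds
  rw [eTmin] at htT
  rw [eSmin] at hsS
  have ht10 : 10 ≤ t := by linarith only [htT, hM₂0, hM₃0, hM₅0, hM₆0, hbq]
  have htε : b₂ * q / (2 * g) ≤ t := by linarith only [htT, hM₂0, hM₃0, hM₅0, hM₆0, hbq]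
  have ht₂ : 100 * M₂ ≤ t := by linarith only [htT, hM₂0, hM₃0, hM₅0, hM₆0, hbq]
  have ht₃ : 100 * M₃ ≤ t := by linarith only [htT, hM₂0, hM₃0, hM₅0, hM₆0, hbq]
  have ht₅ : 100 * M₅ ≤ t := by linarith only [htT, hM₂0, hM₃0, hM₅0, hM₆0, hbq]
  have ht₆ : 400 * M₆ ≤ t := by linarith only [htT, hM₂0, hM₃0, hM₅0, hM₆0, hbq]
  have hs₆ : 400 * M₆' ≤ s := by linarith only [hsS, hM₆'0]
  -- the pieces
  obtain ⟨hε0, hεb, -⟩ := scl_eps hq hg hb₂ ht hG eε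
  have hε12 : ε ≤ 1 / 2 := by
    refine hεb.trans ?_
    rw [div_le_iff₀ ht0]
    have e : b₂ * q / (4 * g) = b₂ * q / (2 * g) / 2 := by ring
    rw [e]; linarith only [htε]
  obtain ⟨hcH0, hcH⟩ := scl_cH hq hg hb₁ hb₂ ht hG hG' eε hε12 heX ecH
  obtain ⟨hCF0, hCF⟩ := scl_CF (q := q) hC hΛ₂ hl ht hs hX hL₁ hL₂ hL eCF
  obtain ⟨hlRW0, hlRW⟩ := scl_lRW hC hq hg hΛ hl ht hs hst hG hRb.le hRb1 hR hX hL₁ hL₂ hL eℓ eRW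
  obtain ⟨hαT0, hαT, -⟩ := scl_alphaT hq hg ht hG eαT
  obtain ⟨hα₅0, hα₅, -⟩ := scl_alphaT hq hg ht hG eα₅
  have hLl : L₁ + L₂ ≤ l := hL.trans (div_le_self hl (one_le_pow₀ ht))
  have hL0 : 0 ≤ L₁ + L₂ := by linarith only [hL₁, hL₂]
  have hX0 : 0 < X := by rw [hX]; positivity
  have hLt1 : (L₁ + L₂) * (C * √q / X) ≤ l * (C * √q) := by
    have h1 : C * √q / X ≤ C * √q := div_le_self (by positivity) (by rw [hX]; linarith only [hs])
    exact mul_le_mul hLl h1 (by positivity) hl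
  obtain ⟨hδT0, hδT⟩ :=
    scl_deltaT hC hq hg hΛ hl hb₁ hb₂ ht hs hst hG hRb.le hRb1 hR hX (by positivity) hLt1 eδT
  have hLt2 : (L₁ + L₂) * (C * √q) ≤ l * (C * √q) := mul_le_mul_of_nonneg_right hLl (by positivity)
  obtain ⟨hδ₅0, hδ₅⟩ :=
    scl_deltaT hC hq hg hΛ hl hb₁ hb₂ ht hs hst hG hRb.le hRb1 hR hX (by positivity) hLt2 eδ₅
  obtain ⟨hθ0, -, hα₁0, hα₁, hδ₁0, hδ₁⟩ :=
    scl_delta1 hC hq hg hΛ hl hb₁ hb₂ ht hs hG hRb hRb1 hR hxs hlg1 egS0 hθ₀ hθ hL₁ hL₂ hL eα₁ eδ₁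
  obtain ⟨hα₂0, hα₂, hδ₂0, hδ₂⟩ := scl_delta2 hC hq hg hΛ hl hb₁ hb₂ ht hs hG hRb.le hRb1 hR hxs hlg2 hL₁ hL₂ hL eα₂ eδ₂
  obtain ⟨hα₃0, hα₃, hδ₃0, hδ₃⟩ := scl_delta3 hC hq hg hΛ hl hb₁ hb₂ ht hs hst hG hRb.le hRb1 hR hL₁ hL₂ hL eα₃ eδ₃
  obtain ⟨-, hα₆0, hα₆, hδ₆0, hδ₆⟩ :=
    scl_delta6 hC hΛ hβ₀ ht hs hε0 hε12 hη hαT0 hαT hδT0 hδT hCF0 hCF hcH0 hcH hlRW0 hlRW eα₆ eδ₆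
  -- numeric consequences
  rw [← eM₁] at hδ₁
  rw [← eM₂] at hδ₂
  rw [← eM₃] at hδ₃
  rw [← eM₅] at hδ₅ hδ₆
  rw [← eM₆', ← eM₆] at hδ₆
  have hd₁ : δ₁ ≤ 1 / 2400 + 1 / 200 := by linarith only [hδ₁, hRbM]
  have hd₂ : δ₂ ≤ 1 / 100 := hδ₂.trans (by rw [div_le_iff₀ ht0]; linarith only [ht₂])
  have hd₃ : δ₃ ≤ 1 / 100 := hδ₃.trans (by rw [div_le_iff₀ ht0]; linarith only [ht₃])
  have hd₅ : δ₅ ≤ 1 / 100 := hδ₅.trans (by rw [div_le_iff₀ ht0]; linarith only [ht₅])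
  have hd₆ : δ₆ ≤ 1 / 4800 + 1 / 400 + 1 / 400 := by
    have h1 : M₆ / t ≤ 1 / 400 := by rw [div_le_iff₀ ht0]; linarith only [ht₆]
    have h2 : M₆' / s ≤ 1 / 400 := by rw [div_le_iff₀ hs0]; linarith only [hs₆]
    linarith only [hδ₆, h1, h2]
  have ha₃ : α₃ ≤ 216 * √q * C ^ 2 * (8 + √q) / g := hα₃.trans (div_le_self (by positivity) ht)
  refine ⟨by linarith only [hd₁, hd₂, hd₃, hd₅, hd₆], ?_, by linarith only [hε12], hθ0, hη0, by rw [hxs]; positivity, ?_,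
    by rw [hX]; linarith only [hs], hG0, hR0⟩
  · rw [eA]; linarith only [hα₁, hα₂, ha₃, hα₅, hα₆]
  · rw [hxs]; exact div_le_div_of_nonneg_left zero_le_one (by norm_num) ht10

/-! ## §2 The `Γ`-dictionary -/

/-- The atoms `t = Γ^{1/8}`, `s = log Γ` for `Γ ≥ max(T_min⁸, e^{S_min})` (`T_min, S_min ≥ 1`). -/
theorem scl_gamma_atoms {Γ Tmin Smin : ℝ} (hT : 1 ≤ Tmin) (hS : 1 ≤ Smin) (hΓT : Tmin ^ 8 ≤ Γ) (hΓS : Real.exp Smin ≤ Γ) :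
    0 < Γ ∧ Tmin ≤ Γ ^ (1 / 8 : ℝ) ∧ 1 ≤ Γ ^ (1 / 8 : ℝ) ∧ (Γ ^ (1 / 8 : ℝ)) ^ 8 = Γ ∧ Smin ≤ Real.log Γ ∧ 1 ≤ Real.log Γ ∧
      Real.log Γ ≤ 8 * Γ ^ (1 / 8 : ℝ) ∧ Real.sqrt (Γ * Real.log Γ) = (Γ ^ (1 / 8 : ℝ)) ^ 4 * Real.sqrt (Real.log Γ) ∧
      Real.log (1 / (1 / Γ ^ (1 / 8 : ℝ))) = Real.log Γ / 8 ∧ Real.log Γ / 8 ≤ Real.log (2 / (1 / Γ ^ (1 / 8 : ℝ))) ∧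
      Real.exp (-(4 * Real.log Γ / 2)) = 1 / (Γ ^ (1 / 8 : ℝ)) ^ 16 ∧ Γ ^ (-(1 / 4 : ℝ)) = 1 / (Γ ^ (1 / 8 : ℝ)) ^ 2 := by
  have hT8 : (1 : ℝ) ≤ Tmin ^ 8 := one_le_pow₀ hT
  have hΓ1 : 1 ≤ Γ := hT8.trans hΓT
  have hΓ0 : 0 < Γ := by linarith
  set t := Γ ^ (1 / 8 : ℝ) with ht_def
  have ht8 : t ^ 8 = Γ := by
    rw [ht_def, show (1 / 8 : ℝ) = ((8 : ℕ) : ℝ)⁻¹ by norm_num]; exact Real.rpow_inv_natCast_pow hΓ0.le (by norm_num)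
  have htT : Tmin ≤ t := by
    have h := Real.rpow_le_rpow (by positivity) hΓT (by norm_num : (0 : ℝ) ≤ 1 / 8)
    rwa [show (1 / 8 : ℝ) = ((8 : ℕ) : ℝ)⁻¹ by norm_num, Real.pow_rpow_inv_natCast (by linarith) (by norm_num),
      show ((8 : ℕ) : ℝ)⁻¹ = (1 / 8 : ℝ) by norm_num] at h
  have ht1 : 1 ≤ t := hT.trans htT
  have ht0 : 0 < t := by linarith
  have hsS : Smin ≤ Real.log Γ := (Real.le_log_iff_exp_le hΓ0).2 hΓS
  have hs1 : 1 ≤ Real.log Γ := hS.trans hsS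
  have hst : Real.log Γ ≤ 8 * t := by
    have h := Real.log_le_rpow_div hΓ0.le (by norm_num : (0 : ℝ) < 1 / 8)
    rw [← ht_def] at h; linarith [show t / (1 / 8) = 8 * t by ring]
  have hlogt : Real.log t = Real.log Γ / 8 := by
    have : Real.log Γ = 8 * Real.log t := by rw [← ht8, Real.log_pow]; norm_num
    linarith
  refine ⟨hΓ0, htT, ht1, ht8, hsS, hs1, hst, ?_, ?_, ?_, ?_, ?_⟩
  · rw [Real.sqrt_mul hΓ0.le, ← ht8, show t ^ 8 = (t ^ 4) ^ 2 by ring, Real.sqrt_sq (by positivity)]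
  · rw [one_div_one_div, hlogt]
  · rw [div_div_eq_mul_div, div_one, ← hlogt]
    exact Real.log_le_log ht0 (by linarith)
  · rw [show -(4 * Real.log Γ / 2) = -(Real.log Γ + Real.log Γ) by ring, Real.exp_neg, Real.exp_add, Real.exp_log hΓ0, ← ht8]
    field_simp
  · rw [show (-(1 / 4 : ℝ)) = -((1 / 8 : ℝ) * 2) by norm_num, Real.rpow_neg hΓ0.le, Real.rpow_mul hΓ0.le, ← ht_def, Real.rpow_two]
    field_simp

/-! ## §3 The model estimate in the clause scaling -/

/-- ★ **THE MODEL 13-J∘ IN `L²`, IN THE CLAUSE SCALING (Γ-uniform).**  Fix `q > 0` (core), `0 < g ≤ g′` (`G ∈ [gΓ, g′Γ]`), `Λ, Λ₂ ≥ 0`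
(slip: `|w′| ≤ Λ`, `|w″| ≤ Λ₂`), `b₁, b₂ ≥ 0` (multiplier sizes), `β₀ > 0` (growth `β₀ ≤ ½w′ + Re β₁`) and `l ≥ 0` (multiplier Lipschitz
sizes `L₁ + L₂ ≤ lΓ^{-1/4}`).  Then there is `R_b0 > 0` such that for every `0 < R_b ≤ R_b0` there are `Γ₀` and a `Γ`-FREE constant `A ≥ 0`
with: for all `Γ ≥ Γ₀` and all data as above, every `C¹_c` variation `Y` supported in `[c − R_b√(Γ log Γ), c + R_b√(Γ log Γ)]` (`w(c) = 0`)
satisfies `N(Y) ≤ A·N(𝓛Y)`, `𝓛Y = iG((2/q)Y − K_q∗Y) − wY′ + β₁Y + β₂Ȳ`, `N(f) = (∫‖f‖²)^{1/2}`.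
Proof: `model_l2_estimate_closed` with `x_s = Γ^{-1/8}`, `X = 4 log Γ`, `θ = θ₀/R`, `η = η₀` and `scaling_smallness`.
(MODEL statement; the dictionary to clause data is the clause reduction's business.) -/
theorem model_l2_estimate_scaled {q g g' Λ Λ₂ b₁ b₂ β₀ l : ℝ} (hq : 0 < q) (hg : 0 < g) (hg' : g ≤ g') (hΛ : 0 ≤ Λ) (hΛ₂ : 0 ≤ Λ₂)
    (hb₁ : 0 ≤ b₁) (hb₂ : 0 ≤ b₂) (hβ₀ : 0 < β₀) (hl : 0 ≤ l) :
    ∃ Rb0 : ℝ, 0 < Rb0 ∧ ∀ ⦃Rb : ℝ⦄, 0 < Rb → Rb ≤ Rb0 → ∃ Γ₀ A : ℝ, 0 ≤ A ∧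
    ∀ ⦃Γ : ℝ⦄, Γ₀ ≤ Γ → ∀ ⦃G : ℝ⦄, g * Γ ≤ G → G ≤ g' * Γ →
    ∀ ⦃L₁ L₂ : ℝ⦄, 0 ≤ L₁ → 0 ≤ L₂ → L₁ + L₂ ≤ l * Γ ^ (-(1 / 4 : ℝ)) →
    ∀ {c : ℝ} {Y : ℝ → ℂ}, ContDiff ℝ 1 Y → HasCompactSupport Y →
      (∀ x, x ∉ Set.Icc (c - Rb * Real.sqrt (Γ * Real.log Γ)) (c + Rb * Real.sqrt (Γ * Real.log Γ)) → Y x = 0) →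
    ∀ {w : ℝ → ℝ}, Differentiable ℝ w → Differentiable ℝ (deriv w) → (∀ t, |deriv w t| ≤ Λ) →
      (∀ t, |deriv (deriv w) t| ≤ Λ₂) → w c = 0 →
    ∀ {β₁ β₂ β₂' : ℝ → ℂ}, Continuous β₁ → (∀ τ, ‖β₁ τ‖ ≤ b₁) → (∀ x y, ‖β₁ y - β₁ x‖ ≤ L₁ * |y - x|) →
      (∀ τ, HasDerivAt β₂ (β₂' τ) τ) → Continuous β₂' → (∀ τ, ‖β₂ τ‖ ≤ b₂) → (∀ τ, ‖β₂' τ‖ ≤ L₂) →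
      (∀ τ, β₀ ≤ 1 / 2 * deriv w τ + (β₁ τ).re) →
    (∫ y : ℝ, ‖Y y‖ ^ 2) ^ (1 / 2 : ℝ)
      ≤ A * (∫ y : ℝ, ‖I * (G : ℂ) * ((2 / q : ℂ) * Y y
              - ∫ σ : ℝ, ((((2 * q - (y - σ) ^ 2) * (((y - σ) ^ 2 + q) ^ (5 / 2 : ℝ))⁻¹ : ℝ)) : ℂ) * Y σ)
            - ((w y : ℝ) : ℂ) * deriv Y y + β₁ y * Y y + β₂ y * conj (Y y)‖ ^ 2) ^ (1 / 2 : ℝ) := by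
  obtain ⟨C, hC, hcl⟩ := model_l2_estimate_closed
  -- the Γ-free constants
  obtain ⟨θ₀, hθ₀⟩ : ∃ x : ℝ, x = Real.pi * √q / (4800 * (C ^ 2 + 1)) := ⟨_, rfl⟩
  obtain ⟨η, hη⟩ : ∃ x : ℝ, x = β₀ / (21600 * (1 + C) * Λ + 1) := ⟨_, rfl⟩
  obtain ⟨M₁, eM₁⟩ : ∃ x : ℝ, x = 32 * q * (2 * Λ + l * √q + b₁ + b₂) * C ^ 2 / (θ₀ ^ 2 * g)
      + 1024 * q * Λ ^ 2 * C ^ 2 * (1 + q) / (θ₀ ^ 2 * g ^ 2) := ⟨_, rfl⟩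
  obtain ⟨M₂, eM₂⟩ : ∃ x : ℝ, x = 64 * q * (4 * Λ + l * √q + b₁ + b₂) * C ^ 2 / g + 128 * Λ * C ^ 2 * √q / g := ⟨_, rfl⟩
  obtain ⟨M₃, eM₃⟩ : ∃ x : ℝ, x = 216 * √q * C ^ 2 * (8 + √q) * (3 * Λ + l * √q + b₁ + 3 * b₂) / g := ⟨_, rfl⟩
  obtain ⟨M₅, eM₅⟩ : ∃ x : ℝ, x = 25 * q * (4 * Λ + l * √q + b₁ + b₂) * C ^ 2 / g + 12800 * Λ * C ^ 2 * √q / g := ⟨_, rfl⟩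
  obtain ⟨M₆, eM₆⟩ : ∃ x : ℝ, x = 9 * (1 + C) * Λ * M₅ / (2 * η * β₀)
      + 6 * (1 + C) ^ 2 * (15 * g' / q + b₁ * b₂ * q / (2 * g) + b₂ ^ 2 * q / (4 * g)) / β₀
      + 6 * (1 + C) * (Λ * l * q * (8 * (1 + 2 * C) + C * √q) / (4 * g)) / β₀ := ⟨_, rfl⟩
  obtain ⟨M₆', eM₆'⟩ : ∃ x : ℝ, x = 9 * (1 + C) * ((2 * Λ₂ + l) * C * √q / 4) / β₀ := ⟨_, rfl⟩
  obtain ⟨Tmin, eTmin⟩ : ∃ x : ℝ, x = 10 + b₂ * q / (2 * g) + 100 * M₂ + 100 * M₃ + 100 * M₅ + 400 * M₆ := ⟨_, rfl⟩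
  obtain ⟨Smin, eSmin⟩ : ∃ x : ℝ, x = 1 + 400 * M₆' := ⟨_, rfl⟩
  obtain ⟨A, eA⟩ : ∃ x : ℝ, x = 12 * (32 * q * C ^ 2 / (θ₀ ^ 2 * g) + 64 * q * C ^ 2 / g + 2 * (216 * √q * C ^ 2 * (8 + √q) / g)
      + 25 * q * C ^ 2 / g + 9 * (1 + C) * ((1 + C) + Λ * (25 * q * C ^ 2 / g) / (2 * η)) / β₀) := ⟨_, rfl⟩
  have hsq : 0 < √q := Real.sqrt_pos.2 hq
  have hg'0 : 0 < g' := lt_of_lt_of_le hg hg'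
  have hθ₀0 : 0 < θ₀ := by rw [hθ₀]; positivity
  have hη0 : 0 < η := by rw [hη]; positivity
  have hM₁0 : 0 ≤ M₁ := by rw [eM₁]; positivity
  have hM₂0 : 0 ≤ M₂ := by rw [eM₂]; positivity
  have hM₃0 : 0 ≤ M₃ := by rw [eM₃]; positivity
  have hM₅0 : 0 ≤ M₅ := by rw [eM₅]; positivity
  have hM₆0 : 0 ≤ M₆ := by rw [eM₆]; positivity
  have hM₆'0 : 0 ≤ M₆' := by rw [eM₆']; positivity
  have hbq : 0 ≤ b₂ * q / (2 * g) := by positivity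
  have hTmin1 : 1 ≤ Tmin := by rw [eTmin]; linarith only [hM₂0, hM₃0, hM₅0, hM₆0, hbq]
  have hSmin1 : 1 ≤ Smin := by rw [eSmin]; linarith only [hM₆'0]
  have hA0 : 0 ≤ A := by rw [eA]; positivity
  refine ⟨1 / (200 * M₁ + 1), by positivity, ?_⟩
  intro Rb hRb hRbRb0
  refine ⟨max (Tmin ^ 8) (Real.exp Smin), A, hA0, ?_⟩
  intro Γ hΓ G hGl hGu L₁ L₂ hL₁ hL₂ hL c Y hY hYs hYR w hw hw2 hwΛ hwΛ₂ hwc β₁ β₂ β₂' hβ₁c hb₁' hL₁' hβ₂ hβ₂'c hb₂' hL₂'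
    hgrowth
  -- `R_b ≤ 1` and `R_b·M_δ₁ ≤ 1/200`
  have hRb1 : Rb ≤ 1 := hRbRb0.trans (by rw [div_le_one (by positivity)]; linarith only [hM₁0])
  have hRbM : Rb * M₁ ≤ 1 / 200 := by
    calc Rb * M₁ ≤ 1 / (200 * M₁ + 1) * M₁ := mul_le_mul_of_nonneg_right hRbRb0 hM₁0
      _ ≤ 1 / 200 := by
          rw [div_mul_eq_mul_div, one_mul, div_le_div_iff₀ (by positivity) (by norm_num)]; linarith only [hM₁0]
  -- the atoms `t = Γ^{1/8}`, `s = log Γ`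
  obtain ⟨hΓ0, htT, ht1, ht8, hsS, hs1, hst, hsqrt, hlg1, hlg2, heX, hquarter⟩ :=
    scl_gamma_atoms hTmin1 hSmin1 ((le_max_left _ _).trans hΓ) ((le_max_right _ _).trans hΓ)
  set t := Γ ^ (1 / 8 : ℝ) with ht_def
  set s := Real.log Γ with hs_def
  have hGt : g * t ^ 8 ≤ G := by rw [ht8]; exact hGl
  have hGt' : G ≤ g' * t ^ 8 := by rw [ht8]; exact hGu
  have hLt : L₁ + L₂ ≤ l / t ^ 2 := by have h := hL; rw [hquarter, mul_one_div] at h; exact h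
  obtain ⟨R, hRdef⟩ : ∃ x : ℝ, x = Rb * Real.sqrt (Γ * s) := ⟨_, rfl⟩
  rw [← hRdef] at hYR
  have hR : R = Rb * t ^ 4 * Real.sqrt s := by rw [hRdef, hsqrt]; ring
  -- the eighteen quantities of the closed model theorem, as opaque reals
  obtain ⟨xs, hxs⟩ : ∃ x : ℝ, x = 1 / t := ⟨_, rfl⟩
  obtain ⟨X, hX⟩ : ∃ x : ℝ, x = 4 * s := ⟨_, rfl⟩
  obtain ⟨θ, hθ⟩ : ∃ x : ℝ, x = θ₀ / R := ⟨_, rfl⟩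
  have hlg1' : Real.log (1 / xs) = s / 8 := by rw [hxs]; exact hlg1
  have hlg2' : s / 8 ≤ Real.log (2 / xs) := by rw [hxs]; exact hlg2
  have heX' : Real.exp (-(X / 2)) = 1 / t ^ 16 := by rw [hX]; exact heX
  obtain ⟨gS0, egS0⟩ : ∃ x : ℝ, x = G * (1 / 2 * Real.log (1 / xs)) := ⟨_, rfl⟩
  obtain ⟨ε, eε⟩ : ∃ x : ℝ, x = b₂ * q / (4 * G) := ⟨_, rfl⟩
  obtain ⟨ℓ, eℓ⟩ : ∃ x : ℝ, x = L₂ * q / (4 * G) := ⟨_, rfl⟩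
  obtain ⟨cH, ecH⟩ : ∃ x : ℝ, x = (1 + ε) * G * (2 / q * (5 * Real.exp (-(X / 2)))) + 2 * b₁ * ε + 2 * (2 * G / q) * ε ^ 2 :=
    ⟨_, rfl⟩
  obtain ⟨CF, eCF⟩ : ∃ x : ℝ, x = Λ₂ * ((C * √q / X) + (C * √q / X)) + (L₁ + L₂) * (C * √q / X) := ⟨_, rfl⟩
  obtain ⟨RW, eRW⟩ : ∃ x : ℝ, x = R + Real.sqrt 2 * (C * R + (C * √q / X)) := ⟨_, rfl⟩
  obtain ⟨αT, eαT⟩ : ∃ x : ℝ, x = C ^ 2 / (G * (2 / q * (1 / 50))) := ⟨_, rfl⟩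
  obtain ⟨δT, eδT⟩ : ∃ x : ℝ, x = ((Λ * (C + C) + (L₁ + L₂) * (C * √q / X) + (b₁ + b₂) * C + Real.sqrt 2 * Λ * C)
      + Real.sqrt 2 * Λ * (C * X / √q) * R) * C / (G * (2 / q * (1 / 50))) := ⟨_, rfl⟩
  obtain ⟨α₁, eα₁⟩ : ∃ x : ℝ, x = q / θ ^ 2 * (2 / gS0) * C ^ 2 := ⟨_, rfl⟩
  obtain ⟨δ₁, eδ₁⟩ : ∃ x : ℝ, x = θ / (Real.pi * √q) * C ^ 2 * (2 * R)
      + q / θ ^ 2 * (2 / gS0 * ((Λ * (C + C) + (L₁ + L₂) * (C * √q / xs)) * C + (b₁ + b₂) * C ^ 2)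
        + Λ ^ 2 / gS0 ^ 2 * (2 * (C * R + (C * √q / xs)) ^ 2)) := ⟨_, rfl⟩
  obtain ⟨α₂, eα₂⟩ : ∃ x : ℝ, x = C ^ 2 / (G * (2 / q * (xs ^ 2 / 16 * Real.log (2 / xs)))) := ⟨_, rfl⟩
  obtain ⟨δ₂, eδ₂⟩ : ∃ x : ℝ, x = ((Λ * (C + C) + (L₁ + L₂) * (C * √q / xs) + (b₁ + b₂) * C + Real.sqrt 2 * Λ * C)
      + Real.sqrt 2 * Λ * (C / √q) * R) * C / (G * (2 / q * (xs ^ 2 / 16 * Real.log (2 / xs)))) := ⟨_, rfl⟩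
  obtain ⟨α₃, eα₃⟩ : ∃ x : ℝ, x = √q * (Real.sqrt 2 * ((C + C) * R + ((C * √q) + (C * √q)))) * (C + C) / (G * (153 / 4000)) :=
    ⟨_, rfl⟩
  obtain ⟨δ₃, eδ₃⟩ : ∃ x : ℝ, x = √q * (Real.sqrt 2 * ((C + C) * R + ((C * √q) + (C * √q))))
      * (Λ * ((C + C) + (C + C)) + (L₁ + L₂) * ((C * √q) + (C * √q)) + (Λ + b₁ + 3 * b₂) * (C + C)) / (G * (153 / 4000)) :=
    ⟨_, rfl⟩
  obtain ⟨α₅, eα₅⟩ : ∃ x : ℝ, x = C ^ 2 / (G * (2 / q * (1 / 50))) := ⟨_, rfl⟩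
  obtain ⟨δ₅, eδ₅⟩ : ∃ x : ℝ, x = ((Λ * (C + C) + (L₁ + L₂) * (C * √q) + (b₁ + b₂) * C + Real.sqrt 2 * Λ * C)
      + Real.sqrt 2 * Λ * (C * X / √q) * R) * C / (G * (2 / q * (1 / 50))) := ⟨_, rfl⟩
  obtain ⟨α₆, eα₆⟩ : ∃ x : ℝ, x = (1 + ε) ^ 2 * (1 + C) * ((1 + C) + Λ * αT / (2 * η)) / (β₀ * (1 - ε) ^ 2) := ⟨_, rfl⟩
  obtain ⟨δ₆, eδ₆⟩ : ∃ x : ℝ, x = ((1 + ε) ^ 2 * (1 + C) * Λ * (δT / (2 * η) + η / 2)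
      + (1 + ε) * (1 + C) * ((1 + ε) * CF + cH * (1 + C) + ℓ * Λ * RW)) / (β₀ * (1 - ε) ^ 2) := ⟨_, rfl⟩
  -- the scaling bounds
  obtain ⟨hδ, hαA, hε1, hθ0, hη0', hxs0, hxs10, hX72, hG0, hR0⟩ :=
    scaling_smallness hC hq hg hΛ hΛ₂ hb₁ hb₂ hβ₀ hl ht1 hs1 hst hGt hGt' hRb hRb1 hR hL₁ hL₂ hLt hxs hX hlg1' hlg2' heX'
      hθ₀ hθ hη egS0 eε eℓ ecH eCF eRW eαT eδT eα₁ eδ₁ eα₂ eδ₂ eα₃ eδ₃ eα₅ eδ₅ eα₆ eδ₆ eM₁ eM₂ eM₃ eM₅ eM₆ eM₆' eTmin eSmin eA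
      htT hsS hRbM
  -- the closed model theorem
  have key := hcl hq hG0 hR0 hxs0 hxs10 hX72 hθ0 hη0' hβ₀ hY hYs hYR hw hw2 hwΛ hwΛ₂ hwc hβ₁c hb₁' hL₁' hβ₂ hβ₂'c hb₂' hL₂'
    hgrowth egS0 eε hε1 eℓ ecH eCF eRW eαT eδT eα₁ eδ₁ eα₂ eδ₂ eα₃ eδ₃ eα₅ eδ₅ eα₆ eδ₆ hδ
  exact key.trans (mul_le_mul_of_nonneg_right hαA (Real.rpow_nonneg (integral_nonneg fun _ => sq_nonneg _) _))

end Summit.NavierStokesRegularity.NavierStokesRegularity.Theorems.MatchedKernel
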